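import Summits.SmoothPoincare4.SmoothPoincare4.Theorems.ConvexBisectionAcyclicBisectionRigidityCancelPairClosed
import Summits.SmoothPoincare4.SmoothPoincare4.Theorems.ConvexBisectionAcyclicBisectionRigiditySeamGluingCrux
import Summits.SmoothPoincare4.SmoothPoincare4.Theorems.ConvexBisectionAcyclicBisectionRigidityStubPropertyRClosing
import Literature.Topology.FourManifolds.ClosedAsCobordism
import Literature.Topology.FourManifolds.MorseCountPalindrome
import Literature.Topology.FourManifolds.CerfGammaFour
import Literature.Topology.FourManifolds.HomotopyS4CompactProofs
import HarnessLib

/-!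
# Duality reduction of the Mazur–Mazur sector: profile-`(1, 2, 1)` geometric duality + Cerf +
# Property R (gluing form) ⇒ a Mazur–Mazur Stein bisection of a homotopy `4`-sphere is `S⁴`

Helper file (crux `ConvexBisection.AcyclicBisectionRigidity`, item stmt-SmoothPoincare4-10507,
line `seam-duality-cancellation`; re-land of lead c1's lost `DualityReduction`).  The crux says
that acyclic common-contact Stein bisections `M = e₁(W₁) ∪ e₂(W₂)` of homotopy `4`-spheres are
`S⁴`.  On the MAZUR–MAZUR SECTOR (each half has a handle decomposition with one `1`-handle, one
`2`-handle and no `3`-handle) the glued Morse function on `M`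
(`SeamGluing.exists_isMorse_of_steinBisection_of_hasHandleDecomposition`) has profile
`(a, 1, 2, 1, b)`, and the line's conjectural step ("lever A", the Mazur–Mazur seam lever) is
that its index-`1` point and one of its index-`2` points can be put in Milnor's cancelling
position (Milnor 1965, Def. 5.1: in the level `V_{1+}` the right-hand sphere of the index-`1`
point and the left-hand sphere of the index-`2` point meet in ONE point, transversely).  This
file certifies

  lever A = the PROFILE-RESTRICTED geometric duality `hD`, modulo Cerf (`hC`) and the gluing
  form of the Property R closing (`hR`):

* `nonempty_diffeomorph_sphere_of_mazurBisection` — PROOF.  Glue the adapted Morse functions of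
  the two halves across the seam (`#Crit₁ = c₁ 1 + c₂ 3 = 1`, `#Crit₂ = c₁ 2 + c₂ 2 = 2`,
  `#Crit₃ = c₁ 3 + c₂ 1 = 1`); rearrange into a NICE Morse function on the cobordism
  `(M; ∅, ∅) = Cobordism.ofClosed 3 M` with the same counts (Milnor 1965, Thm. 4.8: the private
  `exists_isNiceMorseFunction_ofClosed_ncard_eq'`, a copy of the tree's
  `Cancellation.exists_isNiceMorseFunction_ofClosed_ncard_eq` kept here so that this file only
  imports built modules); `hD` supplies a nice `g'` with the same counts and a `(1, 2)` pair in
  cancelling position; cancel it on the closed manifold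
  (`Cancellation.exists_isMorse_of_cancelPair`, Milnor's Thm. 5.4):
  the result is a Morse function on `M` with NO critical point of index `1` and ONE of index
  `2`, and `ExchangeRecognition.stub_propertyRClosing` (Cerf + Property R in gluing form,
  Gompf–Scharlemann–Thompson 2010, Prop. 9.2, case `n = 1`) concludes.

Everything is proved; no definitions, no named facts besides the hypotheses `hC`, `hR`, `hD`.

## References

* J. Milnor, *Lectures on the h-cobordism theorem*, Princeton (1965), Def. 3.1, Thm. 4.8
  (PDF p. 25), Def. 5.1 and Thm. 5.4 (PDF p. 27), §1 (closed manifolds as triads `(W; ∅, ∅)`).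
  [MilnorHCobordism1965]
* R. Gompf, M. Scharlemann, A. Thompson, *Fibered knots and potential counterexamples to the
  Property 2R and Slice-Ribbon Conjectures*, Geom. Topol. 14 (2010), Prop. 9.2.
  [GompfScharlemannThompson2010]
* J. Cerf, *Sur les difféomorphismes de la sphère de dimension trois (Γ₄ = 0)*, LNM 53 (1968).
  [CerfDiffeoSphere1968]
-/

noncomputable section

-- The namespace is prescribed by the crux protocol (`Summit.<P>.<Sub>.Theorems.<Crux>.<Line>`
-- with `P = Sub = SmoothPoincare4`), hence the duplicated component.
set_option linter.dupNamespace false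

open scoped Manifold ContDiff Topology ContinuousMap
open Set Function Literature.Topology.FourManifolds Literature.Geometry.Symplectic
open Literature.Topology.FourManifolds.Cobordism

namespace Summit.SmoothPoincare4.SmoothPoincare4.Theorems.AcyclicBisectionRigidity.SeamDualityCancellation

/-- **A Morse function on a nonempty closed `4`-manifold, made nice on the cobordism `(X; ∅, ∅)`
with as many critical points of each index** (Milnor 1965, Def. 3.1 and Thm. 4.8): rescale into
`(0, 1)` (`IsMorse.exists_isMorseFunction_ofClosed`) and rearrange
(`Cobordism.Milnor1965_finalRearrangement_holds`, same critical points and indices).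
[cite: MilnorHCobordism1965, Def. 3.1 (PDF p. 11), Thm. 4.8 (PDF p. 25)] -/
-- adapted from `Cancellation.exists_isNiceMorseFunction_ofClosed_ncard_eq`
-- (`…AcyclicBisectionRigidityDualityIterate.lean`)
private theorem exists_isNiceMorseFunction_ofClosed_ncard_eq' {X : Type} [TopologicalSpace X]
    [T2Space X] [SecondCountableTopology X] [CompactSpace X]
    [ChartedSpace (EuclideanSpace ℝ (Fin 4)) X] [IsManifold (𝓡 4) ∞ X] [Nonempty X] {F : X → ℝ}
    (hF : IsMorse (𝓡 4) F) :
    ∃ g : (Cobordism.ofClosed 3 X).W → ℝ, (Cobordism.ofClosed 3 X).IsNiceMorseFunction g ∧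
      ∀ k, (criticalSetOfIndex (𝓡∂ 4) g k).ncard = (criticalSetOfIndex (𝓡 4) F k).ncard := by
  obtain ⟨A, B, -, hf, hcount⟩ := hF.exists_isMorseFunction_ofClosed (n := 3)
  obtain ⟨g, hg, hcrit, hind⟩ := Cobordism.Milnor1965_finalRearrangement_holds hf
  exact ⟨g, hg, fun k => (ncard_criticalSetOfIndex_congr hcrit hind k).trans (hcount k)⟩

/-- **The Mazur–Mazur seam lever, reduced to profile-restricted geometric duality (modulo Cerf
and the Property R gluing).**  Assume Cerf's `Γ₄ = 0` (`hC`), the gluing form of the Property R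
closing (`hR`: a closed `4`-manifold glued from a compact `(1, 0, 1)` two-handlebody and a compact
connected orientable `(1, 1)` one-handlebody is `S⁴`), and the PROFILE-RESTRICTED duality `hD`:
on every homotopy `4`-sphere `X`, every nice Morse function on `(X; ∅, ∅)` with exactly `1`,
`2`, `1` critical points of index `1`, `2`, `3` can be replaced by a nice Morse function with the
same numbers of critical points of each index admitting a gradient-like field for which some
index-`1` point `p` and index-`2` point `q` have `S_R(p) ∩ S_L(q) = {x₀}` transversely in the
level `V_{1+} = g'⁻¹(plusLevel 3 1)` (Milnor 1965, Def. 5.1).  Then every homotopy `4`-sphere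
`M` bisected along a common contact seam by two compact Stein domains BOTH OF MAZUR TYPE (handle
decompositions with `c 1 = 1`, `c 2 = 1`, `c 3 = 0`) is diffeomorphic to `S⁴`: the glued Morse
function (`exists_isMorse_of_steinBisection_of_hasHandleDecomposition`) has `#Crit₁ = 1`,
`#Crit₂ = 2`, `#Crit₃ = 1`; make it nice on `Cobordism.ofClosed 3 M` with the same counts
(`exists_isNiceMorseFunction_ofClosed_ncard_eq'`), apply `hD`, cancel the pair on the closed
manifold (`exists_isMorse_of_cancelPair`: no index-`1` point and one index-`2` point remain),
and conclude by `stub_propertyRClosing`.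
[cite: MilnorHCobordism1965, Def. 5.1 and Thm. 5.4 (PDF p. 27), Thm. 4.8 (PDF p. 25)]
[cite: GompfScharlemannThompson2010, Prop. 9.2 (proof), case n = 1]
[cite: CerfDiffeoSphere1968, Γ₄ = 0] -/
theorem nonempty_diffeomorph_sphere_of_mazurBisection (hC : cerf_twistedSphere_four)
    (hR : ∀ (P : Type) [TopologicalSpace P] [T2Space P] [SecondCountableTopology P]
      [ChartedSpace (EuclideanHalfSpace 4) P] [IsManifold (𝓡∂ 4) ∞ P] [CompactSpace P]
      (g : P → ℝ), IsMorseAdapted (𝓡∂ 4) g →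
      (∀ z, IsMCriticalPt (𝓡∂ 4) g z → morseIndex (𝓡∂ 4) g z ≤ 2) →
      (criticalSetOfIndex (𝓡∂ 4) g 0).ncard = 1 → criticalSetOfIndex (𝓡∂ 4) g 1 = ∅ →
      (criticalSetOfIndex (𝓡∂ 4) g 2).ncard = 1 →
      ∀ (V : Type) [TopologicalSpace V] [T2Space V] [SecondCountableTopology V]
      [ChartedSpace (EuclideanHalfSpace 4) V] [IsManifold (𝓡∂ 4) ∞ V] [CompactSpace V]
      [ConnectedSpace V],
      (∃ f : V → ℝ, IsMorseAdapted (𝓡∂ 4) f ∧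
        (∀ z, IsMCriticalPt (𝓡∂ 4) f z → morseIndex (𝓡∂ 4) f z ≤ 1) ∧
        (criticalSetOfIndex (𝓡∂ 4) f 0).ncard = 1 ∧
        (criticalSetOfIndex (𝓡∂ 4) f 1).ncard = 1) →
      IsOrientable (𝓡∂ 4) V →
      ∀ (bP : BoundaryData (𝓡∂ 4) P (𝓡 3)) (bV : BoundaryData (𝓡∂ 4) V (𝓡 3))
        (φ : bP.carrier ≃ₘ⟮𝓡 3, 𝓡 3⟯ bV.carrier) (X : Type) [TopologicalSpace X] [T2Space X]
        [SecondCountableTopology X] [CompactSpace X] [ChartedSpace (EuclideanSpace ℝ (Fin 4)) X]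
        [IsManifold (𝓡 4) ∞ X],
      IsBoundaryGluing bP bV φ (𝓡 4) X →
      Nonempty (X ≃ₘ⟮𝓡 4, 𝓡 4⟯ Metric.sphere (0 : EuclideanSpace ℝ (Fin 5)) 1))
    (hD : ∀ (X : Type) [TopologicalSpace X] [T2Space X] [SecondCountableTopology X]
      [CompactSpace X] [ChartedSpace (EuclideanSpace ℝ (Fin 4)) X] [IsManifold (𝓡 4) ∞ X],
      X ≃ₕ (Metric.sphere (0 : EuclideanSpace ℝ (Fin 5)) 1) →
      ∀ g : (Cobordism.ofClosed 3 X).W → ℝ, (Cobordism.ofClosed 3 X).IsNiceMorseFunction g →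
      (criticalSetOfIndex (𝓡∂ 4) g 1).ncard = 1 → (criticalSetOfIndex (𝓡∂ 4) g 2).ncard = 2 →
      (criticalSetOfIndex (𝓡∂ 4) g 3).ncard = 1 →
      ∃ g' : (Cobordism.ofClosed 3 X).W → ℝ, (Cobordism.ofClosed 3 X).IsNiceMorseFunction g' ∧
        (∀ i, (criticalSetOfIndex (𝓡∂ 4) g' i).ncard = (criticalSetOfIndex (𝓡∂ 4) g i).ncard) ∧
        ∃ (ξ : Cₛ^∞⟮𝓡∂ 4; EuclideanSpace ℝ (Fin 4),
            (TangentSpace (𝓡∂ 4) : (Cobordism.ofClosed 3 X).W → Type)⟯)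
          (_ : IsGradientLike (𝓡∂ 4) g' ξ) (p q x₀ : (Cobordism.ofClosed 3 X).W),
          p ∈ criticalSetOfIndex (𝓡∂ 4) g' 1 ∧ q ∈ criticalSetOfIndex (𝓡∂ 4) g' 2 ∧
          rightHandSphere (𝓡∂ 4) g' ξ p (plusLevel 3 1) ∩
              leftHandSphere (𝓡∂ 4) g' ξ q (plusLevel 3 1) = {x₀} ∧
          IsTransverseInLevel (𝓡∂ 4) (g' ⁻¹' {plusLevel 3 1})
            (rightHandSphere (𝓡∂ 4) g' ξ p (plusLevel 3 1))
            (leftHandSphere (𝓡∂ 4) g' ξ q (plusLevel 3 1)) x₀)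
    (M : Type) [TopologicalSpace M] [T2Space M] [SecondCountableTopology M]
    [ChartedSpace (EuclideanSpace ℝ (Fin 4)) M] [IsManifold (𝓡 4) ∞ M]
    (hM : M ≃ₕ (Metric.sphere (0 : EuclideanSpace ℝ (Fin 5)) 1))
    (W₁ : Type) [TopologicalSpace W₁] [ChartedSpace (EuclideanHalfSpace 4) W₁]
    [IsManifold (𝓡∂ 4) ∞ W₁] [CompactSpace W₁]
    (W₂ : Type) [TopologicalSpace W₂] [ChartedSpace (EuclideanHalfSpace 4) W₂]
    [IsManifold (𝓡∂ 4) ∞ W₂] [CompactSpace W₂]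
    (J₁ : SteinStructure W₁) (J₂ : SteinStructure W₂) (e₁ : W₁ → M) (e₂ : W₂ → M)
    (he₁ : Manifold.IsSmoothEmbedding (𝓡∂ 4) (𝓡 4) ∞ e₁)
    (he₂ : Manifold.IsSmoothEmbedding (𝓡∂ 4) (𝓡 4) ∞ e₂)
    (hcover : range e₁ ∪ range e₂ = univ)
    (hseam₁ : range e₁ ∩ range e₂ = e₁ '' (𝓡∂ 4).boundary W₁)
    (hseam₂ : range e₁ ∩ range e₂ = e₂ '' (𝓡∂ 4).boundary W₂)
    (hξ : ∀ w₁ w₂, e₁ w₁ = e₂ w₂ →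
      Submodule.map (mfderiv (𝓡∂ 4) (𝓡 4) e₁ w₁).toLinearMap (contactPlane J₁.J w₁) =
      Submodule.map (mfderiv (𝓡∂ 4) (𝓡 4) e₂ w₂).toLinearMap (contactPlane J₂.J w₂))
    {c₁ c₂ : ℕ → ℕ} (h₁ : HasHandleDecomposition 3 W₁ c₁) (h₂ : HasHandleDecomposition 3 W₂ c₂)
    (hc₁ : c₁ 1 = 1 ∧ c₁ 2 = 1 ∧ c₁ 3 = 0) (hc₂ : c₂ 1 = 1 ∧ c₂ 2 = 1 ∧ c₂ 3 = 0) :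
    Nonempty (M ≃ₘ⟮𝓡 4, 𝓡 4⟯ Metric.sphere (0 : EuclideanSpace ℝ (Fin 5)) 1) := by
  -- `M` is compact and path connected (in particular nonempty), being homotopy equivalent to `S⁴`
  haveI : CompactSpace M := compactSpace_of_homotopyEquiv_sphere_four_holds M hM
  haveI : PathConnectedSpace (Metric.sphere (0 : EuclideanSpace ℝ (Fin 5)) 1) :=
    pathConnectedSpace_sphere_four
  haveI : PathConnectedSpace M :=
    Literature.Topology.FourManifolds.pathConnectedSpace_of_homotopyEquiv hM
  -- the glued Morse function of the bisection: `#Crit_i = c₁ i + c₂ (4 - i)`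
  obtain ⟨F, hF, hcount⟩ :=
    SeamGluing.exists_isMorse_of_steinBisection_of_hasHandleDecomposition M hM W₁ W₂ J₁ J₂ e₁ e₂
      he₁ he₂ hcover hseam₁ hseam₂ hξ h₁ h₂
  obtain ⟨hc₁1, hc₁2, hc₁3⟩ := hc₁
  obtain ⟨hc₂1, hc₂2, hc₂3⟩ := hc₂
  -- Mazur–Mazur halves: profile `(·, 1, 2, 1, ·)`
  have hF1 : (criticalSetOfIndex (𝓡 4) F 1).ncard = 1 := by have := hcount 1 3 rfl; omega
  have hF2 : (criticalSetOfIndex (𝓡 4) F 2).ncard = 2 := by have := hcount 2 2 rfl; omega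
  have hF3 : (criticalSetOfIndex (𝓡 4) F 3).ncard = 1 := by have := hcount 3 1 rfl; omega
  -- a nice Morse function on `(M; ∅, ∅)` with the counts of `F` (Milnor 1965, Thm. 4.8)
  obtain ⟨g, hg, hgc⟩ := exists_isNiceMorseFunction_ofClosed_ncard_eq' hF
  -- profile-restricted duality: same counts, and a `(1, 2)` pair in cancelling position
  obtain ⟨g', hg', hcount', ξ, hgl, p, q, x₀, hp, hq, hx₀, htr⟩ :=
    hD M hM g hg ((hgc 1).trans hF1) ((hgc 2).trans hF2) ((hgc 3).trans hF3)
  -- Milnor's First Cancellation Theorem on the closed manifold (Thm. 5.4)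
  obtain ⟨F', hF', h1', h2', -⟩ :=
    Cancellation.exists_isMorse_of_cancelPair (n := 3) (k := 1) hg' ξ hgl hp hq hx₀ htr
  have e1 : (criticalSetOfIndex (𝓡 4) F' 1).ncard + 1 =
      (criticalSetOfIndex (𝓡∂ 4) g' 1).ncard := h1'
  have e2 : (criticalSetOfIndex (𝓡 4) F' 2).ncard + 1 =
      (criticalSetOfIndex (𝓡∂ 4) g' 2).ncard := h2'
  rw [hcount' 1, hgc 1, hF1] at e1
  rw [hcount' 2, hgc 2, hF2] at e2
  -- no critical point of index `1`, one of index `2`: Cerf + Property R (gluing form) conclude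
  have hfin1 : (criticalSetOfIndex (𝓡 4) F' 1).Finite :=
    (IsMorse.finite_criticalSet_holds hF').subset (criticalSetOfIndex_subset _ F' 1)
  have h1 : criticalSetOfIndex (𝓡 4) F' 1 = ∅ := (Set.ncard_eq_zero hfin1).1 (by omega)
  exact ExchangeRecognition.stub_propertyRClosing hC hR M hM F' hF' h1 (by omega)

end Summit.SmoothPoincare4.SmoothPoincare4.Theorems.AcyclicBisectionRigidity.SeamDualityCancellation

end
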